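import Literature.AlgebraicTopology.SingularHomology.LocalHomologyIso
import Literature.AlgebraicTopology.SingularHomology.StratumLocalClassCharts
import Literature.AlgebraicTopology.SingularHomology.ExcisionTheorem
import Literature.AlgebraicTopology.SingularHomology.TripleSequence
import HarnessLib

/-!
# The local homology line at a stratum survives in an ambient space carrying a normal coordinate

Pure topology; the discharge pattern for hypothesis (S2) of
`SingularHomology/SupportPropagation` (propagation of the support of a cohomology class from a
fibre to the total space of a family). There one needs, for a map `j : P → U` (the fibre, or its
good part, inside the total space) and a closed `S ⊆ U` (the support), that
`j_* : Hₖ(P, P ∖ j⁻¹S) → Hₖ(U, U ∖ S)` be ONE-TO-ONE. In the application `Hₖ(P, P ∖ j⁻¹S; F)` is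
a line spanned by a transverse disc class (the topological Thom class of a connected locally flat
stratum of real codimension `k`, `SingularHomology/LocallyFlatCriticalDegree`); the local homology
`Hₖ(U, U ∖ S)` of the (non-compact, possibly disconnected) stratum `S` of the total space is not
available in closed form, but `S` carries a NORMAL COORDINATE: a continuous `K : N → ℝᵏ` on an open
neighbourhood `N ⊇ S` with `K⁻¹(0) = S` (in the application `K = (f₁, …, f_p)`, local algebraic
equations of the family of supports on a Zariski-open set, read on complex points). This file
proves that such a coordinate detects the disc class — the homological skeleton of "the
intersection number of a transverse disc with the stratum is `1`" (J. Milnor, *Lectures on the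
h-cobordism theorem* (1965), proof of Lemma 6.3; cf. the tree's `TransverseDiscFunctional`, which
treats the orientation-sensitive version over `ℤ`):

* `map_map_ne_zero_of_normalCoordinate` — for `j : P → U`, `S ⊆ N ⊆ U` (`S` closed, `N` open), a
  normal coordinate `K : N → ℝᵏ` (`K z = 0 ↔ z ∈ S`), a neighbourhood `Q` of `0` in `ℝᵏ` and a
  continuous `m : Q → P` with `j(m(Q)) ⊆ N` and `K (j (m v)) = v` (a transverse disc IN THE FIBRE,
  section of the coordinate): for every non-zero `x ∈ Hₖ(Q, Q ∖ 0; M)` the class `j_* m_* x` of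
  `Hₖ(U, U ∖ S; M)` is non-zero. Proof: the functional
  `Λ = K_* ∘ (excision)⁻¹ : Hₖ(U, U ∖ S) ≅ Hₖ(N, N ∖ S) → Hₖ(ℝᵏ, ℝᵏ ∖ 0)` sends `j_* m_* x` to
  the image of `x` under `Hₖ(Q, Q ∖ 0) ≅ Hₖ(ℝᵏ, ℝᵏ ∖ 0)` (excision at a point).
* `injective_map_of_normalCoordinate_of_span` — if moreover, over a field `F`,
  `Hₖ(P, P ∖ j⁻¹S; F)` is spanned by one class (the Thom line), then
  `j_* : Hₖ(P, P ∖ j⁻¹S; F) → Hₖ(U, U ∖ S; F)` is one-to-one: the disc class `m_* x₀`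
  (`x₀ ≠ 0`, which exists as `Hₖ(ℝᵏ, ℝᵏ ∖ 0; F) ≅ F`) is a multiple of the generator and has
  non-zero image.

Everything is proved; no definitions, no named facts.

## References

* [MilnorHCobordism1965] J. Milnor, Lectures on the h-cobordism theorem, Princeton 1965, proof
  of Lemma 6.3 (PDF p. 37).
* [HatcherAT2002] A. Hatcher, Algebraic Topology, CUP 2002, Thm. 2.20 (excision), §3.3 p. 231
  (local homology of `ℝᵏ`).
-/

noncomputable section

open CategoryTheory Set

universe v

namespace Literature.AlgebraicTopology.SingularHomology

section NormalCoordinate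

variable (R : Type v) [CommRing R] (M : Type v) [AddCommGroup M] [Module R M]
variable {P U : Type} [TopologicalSpace P] [TopologicalSpace U] (j : C(P, U)) {S N : Set U}
  {k : ℕ} (K : C(↥N, RVec k)) {Q : Set (RVec k)} (m : C(↥Q, P))

/-- A map `j : P → U` is a map of pairs `(P, P ∖ j⁻¹S) → (U, U ∖ S)`. [folklore] -/
theorem mapsTo_preimage_compl (S : Set U) : MapsTo j (j ⁻¹' S)ᶜ Sᶜ := fun _ hx ↦ hx

/-- A normal coordinate `K : N → ℝᵏ` of `S` (`K z = 0 ↔ z ∈ S`) is a map of pairs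
`(N, N ∖ S) → (ℝᵏ, ℝᵏ ∖ 0)`. [folklore] -/
theorem mapsTo_normalCoordinate (hK : ∀ z : ↥N, K z = 0 ↔ (z : U) ∈ S) :
    MapsTo K (Subtype.val ⁻¹' Sᶜ) ({0}ᶜ : Set (RVec k)) :=
  fun z hz h0 ↦ hz ((hK z).1 h0)

/-- A section `m : Q → P` of the normal coordinate through `j` (`K (j (m v)) = v`) is a map of pairs
`(Q, Q ∖ 0) → (P, P ∖ j⁻¹S)`. [folklore] -/
theorem mapsTo_section (hK : ∀ z : ↥N, K z = 0 ↔ (z : U) ∈ S) (hQ : (0 : RVec k) ∈ Q)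
    (hmN : ∀ v, j (m v) ∈ N) (hKm : ∀ v : ↥Q, K ⟨j (m v), hmN v⟩ = v.1) :
    MapsTo m ({(⟨0, hQ⟩ : ↥Q)}ᶜ : Set ↥Q) (j ⁻¹' S)ᶜ := by
  intro v hv hvS
  apply hv
  rw [mem_singleton_iff]
  have h0 : K ⟨j (m v), hmN v⟩ = 0 := (hK _).2 hvS
  rw [hKm] at h0
  exact Subtype.ext h0

/-- **A normal coordinate detects the transverse disc class.** Let `j : P → U`, `S ⊆ N ⊆ U` with
`S` closed and `N` open, `K : N → ℝᵏ` a normal coordinate of `S` (`K z = 0 ↔ z ∈ S`), `Q ⊆ ℝᵏ` a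
neighbourhood of `0`, and `m : Q → P` continuous with `j (m Q) ⊆ N` and `K (j (m v)) = v`. Then for
every non-zero `x ∈ Hₖ(Q, Q ∖ 0; M)` the class `j_* (m_* x) ∈ Hₖ(U, U ∖ S; M)` is non-zero: the
composite `K_* ∘ (excision Hₖ(N, N ∖ S) ≅ Hₖ(U, U ∖ S))⁻¹` maps it to the image of `x` under the
excision isomorphism `Hₖ(Q, Q ∖ 0) ≅ Hₖ(ℝᵏ, ℝᵏ ∖ 0)`.
[cite: MilnorHCobordism1965, proof of Lemma 6.3 (PDF p. 37)] [cite: HatcherAT2002, Thm. 2.20] -/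
theorem map_map_ne_zero_of_normalCoordinate (hS : IsClosed S) (hN : IsOpen N) (hSN : S ⊆ N)
    (hK : ∀ z : ↥N, K z = 0 ↔ (z : U) ∈ S) (hQ : (0 : RVec k) ∈ interior Q)
    (hmN : ∀ v, j (m v) ∈ N) (hKm : ∀ v : ↥Q, K ⟨j (m v), hmN v⟩ = v.1)
    (x : localHomology R M ↥Q ⟨0, interior_subset hQ⟩ k) (hx : x ≠ 0) :
    relativeSingularHomology.map R M j (mapsTo_preimage_compl j S) k
      (relativeSingularHomology.map R M m
        (mapsTo_section j K m hK (interior_subset hQ) hmN hKm) k x) ≠ 0 := by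
  have hQ0 : (0 : RVec k) ∈ Q := interior_subset hQ
  -- excision `Hₖ(N, N ∖ S) ≅ Hₖ(U, U ∖ S)`
  have hcov : interior Sᶜ ∪ interior N = univ := by
    rw [hS.isOpen_compl.interior_eq, hN.interior_eq]
    exact eq_univ_of_forall fun z ↦ (em (z ∈ S)).elim (fun h ↦ Or.inr (hSN h)) Or.inl
  haveI hexc := relativeSingularHomology.isIso_map_of_interior_union_interior_holds R M U Sᶜ N hcov k
  set exc := relativeSingularHomology.map R M (X := ↥N) (subsetIncl N)
    (mapsTo_preimage Subtype.val Sᶜ : MapsTo _ (Subtype.val ⁻¹' Sᶜ) Sᶜ) k with hexcdef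
  -- the functional `Λ = K_* ∘ exc⁻¹`
  let Λ : relativeSingularHomology R M U Sᶜ k ⟶ localHomology R M (RVec k) 0 k :=
    inv exc ≫ relativeSingularHomology.map R M K (mapsTo_normalCoordinate K hK) k
  -- `j ∘ m` factors through `N`
  let jm : C(↥Q, ↥N) := ⟨fun v ↦ ⟨j (m v), hmN v⟩, by fun_prop⟩
  have hjm : MapsTo jm ({(⟨0, hQ0⟩ : ↥Q)}ᶜ : Set ↥Q) (Subtype.val ⁻¹' Sᶜ) := by
    intro v hv hvS
    exact mapsTo_section j K m hK hQ0 hmN hKm hv hvS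
  have hfac : j.comp m = (subsetIncl N).comp jm := rfl
  have hKjm : K.comp jm = subsetIncl Q := ContinuousMap.ext fun v ↦ hKm v
  -- `Λ (j_* m_* x) = (Q ⊆ ℝᵏ)_* x`
  have hΛ : Λ (relativeSingularHomology.map R M j (mapsTo_preimage_compl j S) k
      (relativeSingularHomology.map R M m (mapsTo_section j K m hK hQ0 hmN hKm) k x)) =
      relativeSingularHomology.map R M (subsetIncl Q) (localHomology.mapsTo_subsetIncl_compl hQ0) k x := by
    have h1 : relativeSingularHomology.map R M j (mapsTo_preimage_compl j S) k
        (relativeSingularHomology.map R M m (mapsTo_section j K m hK hQ0 hmN hKm) k x) =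
        exc (relativeSingularHomology.map R M jm hjm k x) := by
      rw [← ModuleCat.comp_apply, ← relativeSingularHomology.map_comp, hexcdef, ← ModuleCat.comp_apply,
        ← relativeSingularHomology.map_comp]
      rfl
    rw [h1]
    change (exc ≫ inv exc ≫ relativeSingularHomology.map R M K (mapsTo_normalCoordinate K hK) k)
      (relativeSingularHomology.map R M jm hjm k x) = _
    rw [IsIso.hom_inv_id_assoc, ← ModuleCat.comp_apply, ← relativeSingularHomology.map_comp,
      relativeSingularHomology.map_congr R M hKjm ((mapsTo_normalCoordinate K hK).comp hjm)
        (localHomology.mapsTo_subsetIncl_compl hQ0) k]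
  -- which is non-zero, `Hₖ(Q, Q ∖ 0) ≅ Hₖ(ℝᵏ, ℝᵏ ∖ 0)` being an isomorphism
  haveI hι := localHomology.isIso_map_subsetIncl_of_mem_interior R M hQ k
  intro h0
  have h2 : relativeSingularHomology.map R M (subsetIncl Q) (localHomology.mapsTo_subsetIncl_compl hQ0) k x = 0 := by
    rw [← hΛ, h0, map_zero]
  apply hx
  have hinj : Function.Injective (relativeSingularHomology.map R M (subsetIncl Q)
      (localHomology.mapsTo_subsetIncl_compl hQ0) k) :=
    ((forget (ModuleCat R)).mapIso (asIso (relativeSingularHomology.map R M (subsetIncl Q)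
      (localHomology.mapsTo_subsetIncl_compl hQ0) k))).toEquiv.injective
  exact hinj (by rw [h2, map_zero])

/-- **The Thom line survives in an ambient space carrying a normal coordinate.** Under the
hypotheses of `map_map_ne_zero_of_normalCoordinate`, over a field `F`: if `Hₖ(P, P ∖ j⁻¹S; F)` is
spanned by one class, then `j_* : Hₖ(P, P ∖ j⁻¹S; F) → Hₖ(U, U ∖ S; F)` is one-to-one (the disc
class `m_* x₀`, `x₀ ≠ 0` in `Hₖ(Q, Q ∖ 0; F) ≅ F`, lies on the line and has non-zero image).
[cite: MilnorHCobordism1965, proof of Lemma 6.3 (PDF p. 37)] [cite: HatcherAT2002, Thm. 2.20 and §3.3 p. 231] -/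
theorem injective_map_of_normalCoordinate_of_span (F : Type) [Field F] {P U : Type}
    [TopologicalSpace P] [TopologicalSpace U] (j : C(P, U)) {S N : Set U} {k : ℕ}
    (K : C(↥N, RVec k)) {Q : Set (RVec k)} (m : C(↥Q, P)) (hS : IsClosed S) (hN : IsOpen N)
    (hSN : S ⊆ N) (hK : ∀ z : ↥N, K z = 0 ↔ (z : U) ∈ S) (hQ : (0 : RVec k) ∈ interior Q)
    (hmN : ∀ v, j (m v) ∈ N) (hKm : ∀ v : ↥Q, K ⟨j (m v), hmN v⟩ = v.1)
    (hline : ∃ θ : relativeSingularHomology F F P (j ⁻¹' S)ᶜ k,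
      ∀ y : relativeSingularHomology F F P (j ⁻¹' S)ᶜ k, y ∈ Submodule.span F {θ}) :
    Function.Injective (relativeSingularHomology.map F F j (mapsTo_preimage_compl j S) k) := by
  have hQ0 : (0 : RVec k) ∈ Q := interior_subset hQ
  -- a non-zero class `x₀ ∈ Hₖ(Q, Q ∖ 0; F)`: `Hₖ(Q, Q ∖ 0) ≅ Hₖ(ℝᵏ, ℝᵏ ∖ 0) ≅ F`
  haveI hι := localHomology.isIso_map_subsetIncl_of_mem_interior F F hQ k
  let ι := asIso (relativeSingularHomology.map F F (subsetIncl Q)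
    (localHomology.mapsTo_subsetIncl_compl hQ0) k)
  let e : localHomology F F (RVec k) 0 k ≅ ModuleCat.of F (ULift.{0} F) :=
    localHomologyIsoOfChart' F F (OpenPartialHomeomorph.refl (RVec k)) (mem_univ (0 : RVec k))
  let x₀ : localHomology F F ↥Q ⟨0, hQ0⟩ k := ι.inv (e.inv (ULift.up 1))
  have hx₀ : x₀ ≠ 0 := by
    intro h0
    have h1 : e.hom (ι.hom x₀) = ULift.up 1 := by
      change e.hom (ι.hom (ι.inv (e.inv (ULift.up 1)))) = ULift.up 1
      rw [Iso.inv_hom_id_apply, Iso.inv_hom_id_apply]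
    rw [h0, map_zero, map_zero] at h1
    exact one_ne_zero (congrArg ULift.down h1).symm
  have hne := map_map_ne_zero_of_normalCoordinate F F j K m hS hN hSN hK hQ hmN hKm x₀ hx₀
  -- the disc class lies on the line
  obtain ⟨θ, hθ⟩ := hline
  obtain ⟨a, ha⟩ := Submodule.mem_span_singleton.1
    (hθ (relativeSingularHomology.map F F m (mapsTo_section j K m hK hQ0 hmN hKm) k x₀))
  have hθne : relativeSingularHomology.map F F j (mapsTo_preimage_compl j S) k θ ≠ 0 := by
    intro h0
    apply hne
    rw [← ha, map_smul, h0, smul_zero]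
  -- one-to-one on the line
  intro y₁ y₂ h12
  obtain ⟨b₁, rfl⟩ := Submodule.mem_span_singleton.1 (hθ y₁)
  obtain ⟨b₂, rfl⟩ := Submodule.mem_span_singleton.1 (hθ y₂)
  rw [map_smul, map_smul] at h12
  have hb : b₁ = b₂ := by
    by_contra hb
    apply hθne
    have h3 : (b₁ - b₂) • relativeSingularHomology.map F F j (mapsTo_preimage_compl j S) k θ = 0 := by
      rw [sub_smul, h12, sub_self]
    exact (smul_eq_zero.1 h3).resolve_left (sub_ne_zero.2 hb)
  rw [hb]

end NormalCoordinate

end Literature.AlgebraicTopology.SingularHomology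

end
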